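/-
Copyright (c) 2026 the pub-hodgecm-mathlib formalisation cell (harness21).  Prover seat hodgecm-mathlib-K2-defs1 (g6), Track B, h413 = `stmt-HodgeConjecture-24833`, route `HCCMUnconditional`,
campaign «5Res ∕ R8₂ (χ,τ) EXHAUSTION», item C6 (dealer K2E1-plan (g7) (162) 2026-09-04T11:49:55Z «C6 shrinks to ONE S-file … after 12d-C»).
-/
import Summits.HodgeConjecture.HodgeConjecture.Theorems.K2E1SphericalTransformLevelSetsCountableU   -- ★ T7 (K2E1-p12): `countable_setOf_line_eq_of_differentiable`; brings ★ T6 `ae_eq_zero_of_ae_smul_eq_smul_of_null`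
import Mathlib.LinearAlgebra.Eigenspace.Basic
import HarnessLib

/-!
# R8₂ (χ,τ) item C6 — `K2E1ChiSphericalSymbolLevelSetsU2`: THE (χ,τ)-TWISTED TWIN OF ★ T7∕T6 — a SCALAR HECKE SYMBOL `s(z)` (the archimedean symbol of ★ 12d-C: `𝔥_h(z) = s(z)·1` on `V(χ,K′,ω)`),
# ENTIRE and NON-CONSTANT, has COUNTABLE (hence diffuse-null) level sets on every vertical line, so the matrix multiplication operator `t ↦ 𝔥(σ + it)` on `V`-valued functions HAS NO EIGENVECTORS

Cell `pub/hodgecm-mathlib`, crux H413 = `stmt-HodgeConjecture-24833`.  THEOREMS ONLY (no `def`, no `instance`, no notation, no named-fact hypothesis, no `sorry`); lane `--supports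
stmt-HodgeConjecture-24833 --as helper` (count-neutral).  Closes no socket.  Group-free: a finite-dimensional (or any) complex vector space `V`, a symbol `s : ℂ → ℂ`, a matrix family `𝔥 : ℂ → End V`.

THE MATHEMATICS ([Iwaniec2002, §7]; [Borel1997, §13]; [MoeglinWaldspurger1995, II.1.2]).  In the (χ,τ) Eisenstein part of the spectral decomposition a vector is a `V`-valued function `f(t)` on the
unitary axis `z = σ + it`, and a test function `h` acts by the Hecke MATRIX `𝔥(σ + it) ∈ End V` (★ row 10).  For the ARCHIMEDEAN-ONLY `K_∞`-central `h = h_∞ ⊗ 𝟙_U` of ★ 12d-C the matrix is a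
SCALAR, `𝔥(z) = s(z)·1` with `s` entire; if `s` is non-constant (letter `hnc`, as in ★ 12c) then (§1, ★ T7 §1) `{t | s(σ + it) = c}` is countable, hence null for every measure on `ℝ` without
atoms, so (§2, ★ T6) an a.e. solution of `s(σ + it)·f(t) = c·f(t)` vanishes a.e., and (§3) so does an a.e. joint eigenvector of the matrices, `𝔥(σ + it)(f t) = c·f(t)` — the (χ,τ) replacement of ★
T7's spherical `ae_eq_zero_of_ae_sphericalTransform_smul_eq_smul` (there `s = ĥ`, non-constant letter-free for `h ≥ 0`).  §4 records that `s` IS entire as soon as the matrix family is point-wise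
entire (★ row 10 `exists_heckeEnd`, third clause) and `V ≠ 0` — so the only letter left is the non-constancy `hnc`.
* §1 `measure_setOf_symbol_line_eq_zero` (entire `s ≢ c` ⇒ `ν {t | s(σ+it) = c} = 0`, `ν` diffuse).
* §2 **`ae_eq_zero_of_ae_symbol_smul_eq_smul`** (scalar form), `…_of_not_const` (on the non-constancy letter).
* §3 **`ae_eq_zero_of_ae_heckeEnd_apply_eq_smul`** (matrix form on `h𝔥 : ∀ z, 𝔥 z = s z • 1`).
* §4 `differentiable_symbol_of_heckeEnd_eq_smul` (`s` entire from the point-wise entire matrix family and one non-zero value).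
HONEST LABEL: HC_CM is proved only modulo the 7 printed citations (2 remaining named inputs: hLiu418 = `stmt-HodgeConjecture-24832`, h413 = `stmt-HodgeConjecture-24833`) until rung 0
closes; count-neutral helper, closes no socket.  NOT proved here: the non-constancy `hnc` of the archimedean symbol.

## References
* [Iwaniec2002] H. Iwaniec, *Spectral Methods of Automorphic Forms*, 2nd ed., GSM 53 (2002), §7 (p. 103).
* [Borel1997] A. Borel, *Automorphic Forms on SL₂(ℝ)* (1997), §13.
* [MoeglinWaldspurger1995] C. Mœglin, J.-L. Waldspurger, *Spectral Decomposition and Eisenstein Series* (1995), II.1.2.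
* [ReedSimonI1980] M. Reed, B. Simon, *Methods of Modern Mathematical Physics I* (1980), §VII.2.
-/

set_option autoImplicit false
-- the mandated namespace repeats the single-problem summit's segment (`HodgeConjecture.HodgeConjecture`)
set_option linter.dupNamespace false

noncomputable section

open MeasureTheory Set Filter Complex
open Summit.HodgeConjecture.HodgeConjecture.Cruxes.H413.K2E1SphericalTransformLevelSetsCountableU (countable_setOf_line_eq_of_differentiable)
open Summit.HodgeConjecture.HodgeConjecture.Cruxes.H413.K2E1ProjectionCommutingMultiplicationOperators (ae_eq_zero_of_ae_smul_eq_smul_of_null)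

namespace Summit.HodgeConjecture.HodgeConjecture.Cruxes.H413.K2E1ChiSphericalSymbolLevelSetsU2

/-! ## §1 Null line level sets of an entire non-constant scalar symbol -/

/-- **THE LINE LEVEL SETS OF AN ENTIRE `s ≢ c` ARE NULL** for every measure on `ℝ` without atoms (★ T7 `countable_setOf_line_eq_of_differentiable` + `Set.Countable.measure_zero`). [cite: Iwaniec2002, §7 (p. 103)] -/
theorem measure_setOf_symbol_line_eq_zero {s : ℂ → ℂ} (hs : Differentiable ℂ s) {c₀ : ℂ} (hne : ∃ z, s z ≠ c₀) (σ : ℝ)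
    [MeasurableSpace ℝ] (ν : Measure ℝ) [NullSingletonClass ν] :
    ν {t : ℝ | s ((σ : ℂ) + (t : ℂ) * I) = c₀} = 0 :=
  (countable_setOf_line_eq_of_differentiable hs hne σ).measure_zero ν

/-- Non-constancy in the letter form of ★ 12c (`¬ ∃ w, ∀ z, s z = w`) gives `∃ z, s z ≠ c₀` for every `c₀`. [folklore] -/
theorem exists_ne_of_not_const {s : ℂ → ℂ} (hnc : ¬ ∃ w : ℂ, ∀ z, s z = w) (c₀ : ℂ) : ∃ z, s z ≠ c₀ := by
  by_contra h
  push Not at h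
  exact hnc ⟨c₀, h⟩

/-! ## §2 Scalar form: `s(σ + it)·f(t) = c·f(t)` a.e. forces `f = 0` a.e. -/

section Scalar

variable {V : Type*} [AddCommGroup V] [Module ℂ V] [MeasurableSpace ℝ] {ν : Measure ℝ} [NullSingletonClass ν]

/-- **THE MULTIPLICATION OPERATOR `M_{s(σ + i·)}` HAS NO EIGENVECTORS** for an entire symbol `s` with `s ≢ c₀`: an a.e. solution `f : ℝ → V` of `s(σ + it)·f(t) = c₀·f(t)` vanishes `ν`-a.e.
(`ν` without atoms; `V` any complex vector space — ★ T6 `ae_eq_zero_of_ae_smul_eq_smul_of_null` on the null level set of §1). [cite: Iwaniec2002, §7 (p. 103)] [cite: ReedSimonI1980, §VII.2] -/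
theorem ae_eq_zero_of_ae_symbol_smul_eq_smul {s : ℂ → ℂ} (hs : Differentiable ℂ s) (σ : ℝ) {c₀ : ℂ} (hne : ∃ z, s z ≠ c₀) {f : ℝ → V}
    (hf : ∀ᵐ t ∂ν, s ((σ : ℂ) + ((t : ℝ) : ℂ) * I) • f t = c₀ • f t) : f =ᵐ[ν] 0 :=
  ae_eq_zero_of_ae_smul_eq_smul_of_null hf (measure_setOf_symbol_line_eq_zero hs hne σ ν)

/-- The same on the NON-CONSTANCY letter `hnc` of ★ 12c (every `c₀` at once). [cite: Iwaniec2002, §7 (p. 103)] -/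
theorem ae_eq_zero_of_ae_symbol_smul_eq_smul_of_not_const {s : ℂ → ℂ} (hs : Differentiable ℂ s) (hnc : ¬ ∃ w : ℂ, ∀ z, s z = w) (σ : ℝ) (c₀ : ℂ)
    {f : ℝ → V} (hf : ∀ᵐ t ∂ν, s ((σ : ℂ) + ((t : ℝ) : ℂ) * I) • f t = c₀ • f t) : f =ᵐ[ν] 0 :=
  ae_eq_zero_of_ae_symbol_smul_eq_smul hs σ (exists_ne_of_not_const hnc c₀) hf

end Scalar

/-! ## §3 Matrix form: no a.e. eigenvector for a scalar Hecke matrix family `𝔥(z) = s(z)·1` -/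

section Matrix

variable {V : Type*} [AddCommGroup V] [Module ℂ V] [MeasurableSpace ℝ] {ν : Measure ℝ} [NullSingletonClass ν]

/-- **NO JOINT EIGENVECTOR IN THE (χ,τ) EISENSTEIN PART**: if the Hecke matrix family of ONE test function is scalar, `𝔥 z = s z • 1` (★ 12d-C for an archimedean-only `K_∞`-central `h`), with
`s` entire and `s ≢ c₀`, then every `V`-valued `f` with `𝔥(σ + it)(f t) = c₀·f(t)` for `ν`-a.e. `t` vanishes `ν`-a.e. — the (χ,τ) twin of ★ T7 §4. [cite: Iwaniec2002, §7 (p. 103)] [cite: Borel1997, §13] -/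
theorem ae_eq_zero_of_ae_heckeEnd_apply_eq_smul (𝔥 : ℂ → Module.End ℂ V) {s : ℂ → ℂ} (h𝔥 : ∀ z, 𝔥 z = s z • (1 : Module.End ℂ V))
    (hs : Differentiable ℂ s) (σ : ℝ) {c₀ : ℂ} (hne : ∃ z, s z ≠ c₀) {f : ℝ → V}
    (hf : ∀ᵐ t ∂ν, 𝔥 ((σ : ℂ) + ((t : ℝ) : ℂ) * I) (f t) = c₀ • f t) : f =ᵐ[ν] 0 := by
  refine ae_eq_zero_of_ae_symbol_smul_eq_smul hs σ hne (hf.mono fun t ht => ?_)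
  rwa [h𝔥, LinearMap.smul_apply, Module.End.one_apply] at ht

/-- Matrix form on the non-constancy letter. [cite: Iwaniec2002, §7 (p. 103)] -/
theorem ae_eq_zero_of_ae_heckeEnd_apply_eq_smul_of_not_const (𝔥 : ℂ → Module.End ℂ V) {s : ℂ → ℂ} (h𝔥 : ∀ z, 𝔥 z = s z • (1 : Module.End ℂ V))
    (hs : Differentiable ℂ s) (hnc : ¬ ∃ w : ℂ, ∀ z, s z = w) (σ : ℝ) (c₀ : ℂ) {f : ℝ → V}
    (hf : ∀ᵐ t ∂ν, 𝔥 ((σ : ℂ) + ((t : ℝ) : ℂ) * I) (f t) = c₀ • f t) : f =ᵐ[ν] 0 :=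
  ae_eq_zero_of_ae_heckeEnd_apply_eq_smul 𝔥 h𝔥 hs σ (exists_ne_of_not_const hnc c₀) hf

end Matrix

/-! ## §4 The symbol of a point-wise entire scalar matrix family is entire -/

/-- **`s` IS ENTIRE** when `𝔥 z = s z • 1` on a space `V` of functions `G → ℂ` (★ row 9's `chiSectionSpace`), the family is point-wise entire (★ row 10 `exists_heckeEnd`, third clause:
`z ↦ (𝔥 z φ) x` entire) and some `φ ∈ V` has `φ x ≠ 0`: `s z = (𝔥 z φ)(x)∕φ(x)`. [cite: MoeglinWaldspurger1995, II.1.2] -/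
theorem differentiable_symbol_of_heckeEnd_eq_smul {G : Type*} (V : Submodule ℂ (G → ℂ)) (𝔥 : ℂ → Module.End ℂ ↥V) {s : ℂ → ℂ}
    (h𝔥 : ∀ z, 𝔥 z = s z • (1 : Module.End ℂ ↥V)) (hdiff : ∀ (φ : ↥V) (x : G), Differentiable ℂ fun z => ((𝔥 z φ : ↥V) : G → ℂ) x)
    (φ : ↥V) (x : G) (hφ : (φ : G → ℂ) x ≠ 0) : Differentiable ℂ s := by
  have h1 : s = fun z => ((𝔥 z φ : ↥V) : G → ℂ) x / (φ : G → ℂ) x := by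
    funext z
    rw [h𝔥 z, LinearMap.smul_apply, Module.End.one_apply, Submodule.coe_smul, Pi.smul_apply, smul_eq_mul, mul_div_cancel_right₀ _ hφ]
  rw [h1]
  exact (hdiff φ x).div_const _

end Summit.HodgeConjecture.HodgeConjecture.Cruxes.H413.K2E1ChiSphericalSymbolLevelSetsU2
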